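import Literature.Computability.AlgebraicComplexity.ReadKDeterminantalRepresentations
import Literature.Computability.AlgebraicComplexity.ReadOncePermanentTree
import Literature.Computability.AlgebraicComplexity.RazElusiveGeneralExistence
import Literature.Computability.AlgebraicComplexity.PermanentCompleteness
import Literature.LinearAlgebra.Matrix.DetFewVariablesNormalForm
import HarnessLib

/-!
# Read-`k` determinantal representations of the permanent — proofs

Companion (theorems only, no new definitions or named facts) to
`ReadKDeterminantalRepresentations.lean`, which vendors Hrubeš–Joglekar 2025, Thm. 7
(`HrubesJoglekar2025_variableSize_perPoly`: every symbolic determinantal representation of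
`perm_n` has variable size `Ω(n^{5/2} / log n)`, characteristic `≠ 2`) and Cor. 8
(`HrubesJoglekar2025_readK_perPoly`: read-`k` representations of `perm_n` need
`k ≥ Ω(√n / log n)`) as named facts.

## Contents

* `variableSize_le_card_mul`: a read-`r` symbolic matrix over the variable set `σ` has variable
  size `≤ |σ| · r` (the sentence before Cor. 8 in print: "if `perm_n` has a read-`k`
  determinantal representation `M` then `M` has variable size at most `n² k`").
* `HrubesJoglekar2025_readK_perPoly_of_variableSize`: **the printed proof of Cor. 8** — Thm. 7
  implies Cor. 8 with the same constant, `c · n^{5/2} / log n ≤ variableSize M ≤ n² r`.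
* The proof of Thm. 7 (sections `Counting`, `Universality`, `PerBlock`, `GadgetSize`, `Blocks`,
  `Assembly` below): `card_le_card_of_surjective_eval` and
  `two_pow_le_of_forall_exists_normalForm` (Thm. 2: a polynomial map onto `F^{2^k}` has `≥ 2^k`
  parameters; the `2s × 2s` normal form has `1 + 4s²`), `exists_subst_perPoly_eq` (Thm. 3 inside
  `perm_n`: substituting constants outside `k` well-placed variables realises every multilinear
  polynomial in them, char `≠ 2`, `n ≥ |V k|`), `two_pow_le_of_block` (`2^k ≤ 1 + 4 s_Z²` for the
  number `s_Z` of entries of `M` from a block `Z`), `sum_blocks_le_variableSize` and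
  `variableSize_ge_blocks` (the `n ⌊n/k⌋` disjoint transversal blocks), and the discharges
  `HrubesJoglekar2025_variableSize_perPoly_holds` (`c = log 2 / 64`, `n₀ = 2^16`,
  `k = ⌊log₂ n⌋ - 3`) and `HrubesJoglekar2025_readK_perPoly_holds`.

Ingredients from other files: `Literature/LinearAlgebra/Matrix/DetFewVariablesNormalForm.lean`
(Lemma 1 as the identity `det (C₀ + ∑ w_q E_{pos q}) = c · det (diag(w, 0) + H)`),
`ReadOncePermanentTree.lean` (the read-once permanent gadget replacing Thm. 3), and
`RazElusiveGeneralExistence.lean` (`exists_aeval_eq_zero_of_card_lt`: more polynomials than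
variables are algebraically dependent, from `MvPolynomial.trdeg_of_isDomain`).

## References

* P. Hrubeš, P. S. Joglekar, *On read-k projections of the determinant*, STACS 2025, LIPIcs 327,
  Art. 53, doi:10.4230/LIPIcs.STACS.2025.53: Thm. 7 (p. 53:5), Cor. 8 (p. 53:6) and the sentence
  between them; Lemma 1, Thms. 2, 3 (pp. 53:3–53:5). Full version ECCC TR24-125.
-/

namespace Literature.Computability.AlgebraicComplexity

open MvPolynomial

universe u v w

variable {k : Type u} {σ : Type v} {m : Type w}

/-- A read-`r` symbolic matrix over finitely many variables has variable size at most
`|σ| · r`: every variable entry is an occurrence of some variable (the count behind "if `perm_n`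
has a read-`k` determinantal representation `M` then `M` has variable size at most `n² k`",
Hrubeš–Joglekar 2025, before Cor. 8). [cite: HrubesJoglekar2025, Cor. 8 (p. 6)] -/
theorem variableSize_le_card_mul [Fintype σ] [Finite m] (M : Matrix m m (σ ⊕ k)) (r : ℕ)
    (hM : IsReadK M r) : variableSize M ≤ Fintype.card σ * r := by
  classical
  haveI : Fintype m := Fintype.ofFinite m
  unfold variableSize
  -- inject the variable entries into the disjoint union of the occurrence sets
  have hinj : Function.Injective (fun x : {ij : m × m // ∃ e : σ, M ij.1 ij.2 = Sum.inl e} =>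
      (⟨x.2.choose, ⟨x.1, x.2.choose_spec⟩⟩ : Σ e : σ, {ij : m × m // M ij.1 ij.2 = Sum.inl e})) := by
    intro x y hxy
    have h := congrArg (fun z => (z.2.1 : m × m)) hxy
    exact Subtype.ext h
  calc Nat.card {ij : m × m // ∃ e : σ, M ij.1 ij.2 = Sum.inl e}
      ≤ Nat.card (Σ e : σ, {ij : m × m // M ij.1 ij.2 = Sum.inl e}) :=
        Nat.card_le_card_of_injective _ hinj
    _ = ∑ e : σ, occurrences M e := by
        rw [Nat.card_eq_fintype_card, Fintype.card_sigma]
        refine Finset.sum_congr rfl fun e _ => ?_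
        rw [occurrences, Nat.card_eq_fintype_card]
    _ ≤ ∑ _e : σ, r := Finset.sum_le_sum fun e _ => hM e
    _ = Fintype.card σ * r := by simp

/-- **Cor. 8 from Thm. 7** (Hrubeš–Joglekar 2025, the printed proof of Cor. 8: "If `perm_n` has
a read-`k` determinantal representation `M` then `M` has variable size at most `n² k`. This
implies: … `k ≥ Ω(√n / log n)`"): the fact `HrubesJoglekar2025_readK_perPoly` follows from the
fact `HrubesJoglekar2025_variableSize_perPoly` with the same constant `c`, since
`c · n^{5/2} / log n ≤ variableSize M ≤ n² · r` gives `c · √n / log n ≤ r`.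
[cite: HrubesJoglekar2025, Cor. 8 (p. 6)] -/
theorem HrubesJoglekar2025_readK_perPoly_of_variableSize
    (h : HrubesJoglekar2025_variableSize_perPoly.{u}) : HrubesJoglekar2025_readK_perPoly.{u} := by
  intro k _ hk
  obtain ⟨c, hc, n₀, H⟩ := h k hk
  refine ⟨c, hc, max n₀ 1, fun n hn r m M hM hR => ?_⟩
  have hn₀ : n₀ ≤ n := le_trans (le_max_left _ _) hn
  have hn1 : (1 : ℝ) ≤ n := by exact_mod_cast le_trans (le_max_right _ _) hn
  have hnpos : (0 : ℝ) < n := by linarith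
  have h1 : c * (n : ℝ) ^ ((5 : ℝ) / 2) / Real.log n ≤ (variableSize M : ℝ) := H n hn₀ m M hM
  have h2 : (variableSize M : ℝ) ≤ (n : ℝ) ^ 2 * r := by
    have := variableSize_le_card_mul M r hR
    rw [Fintype.card_prod, Fintype.card_fin] at this
    exact_mod_cast (by nlinarith [this] : variableSize M ≤ n ^ 2 * r)
  have hpow : (n : ℝ) ^ ((5 : ℝ) / 2) = (n : ℝ) ^ 2 * Real.sqrt n := by
    rw [Real.sqrt_eq_rpow, show ((5 : ℝ) / 2) = (2 : ℝ) + 1 / 2 by norm_num,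
      Real.rpow_add hnpos, Real.rpow_two]
  rw [hpow] at h1
  by_cases hlog : Real.log n ≤ 0
  · -- then `n = 1` and the left-hand side vanishes
    have hlog0 : Real.log n = 0 := le_antisymm hlog (Real.log_nonneg hn1)
    rw [hlog0, div_zero]
    exact_mod_cast Nat.zero_le r
  · push Not at hlog
    have hn2 : (0 : ℝ) < (n : ℝ) ^ 2 := by positivity
    have key : (n : ℝ) ^ 2 * (c * Real.sqrt n / Real.log n) ≤ (n : ℝ) ^ 2 * r := by
      calc (n : ℝ) ^ 2 * (c * Real.sqrt n / Real.log n)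
          = c * ((n : ℝ) ^ 2 * Real.sqrt n) / Real.log n := by ring
        _ ≤ (variableSize M : ℝ) := h1
        _ ≤ (n : ℝ) ^ 2 * r := h2
    exact le_of_mul_le_mul_left key hn2

end Literature.Computability.AlgebraicComplexity

/-! ## The proof of Thm. 7 (Hrubeš–Joglekar 2025)

The sections below prove `HrubesJoglekar2025_variableSize_perPoly` (and hence
`HrubesJoglekar2025_readK_perPoly`) following the printed proof (p. 53:6), with its three
ingredients taken from: `Literature/LinearAlgebra/Matrix/DetFewVariablesNormalForm.lean`
(Lemma 1: a determinant with `s` variable entries is `c · det (diag(w, 0) + H)` with a constant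
`2s × 2s` matrix `H`), the counting of Thm. 2 (`card_le_card_of_surjective_eval` below: a
polynomial map `F^p → F^N` onto `F^N` has `p ≥ N` — cardinalities for finite `F`, algebraic
dependence of `N > p` polynomials in `p` variables plus `MvPolynomial.funext` for infinite `F`),
and the read-once universality of the permanent (`ReadOncePermanentTree.lean`, replacing Thm. 3:
every multilinear polynomial in `k` suitably placed variables is obtained from `perm_n`,
`n ≥ 3 (2^{k+1} - 1) + k`, by substituting constants for the other variables, char `≠ 2`).
-/

namespace Literature.Computability.AlgebraicComplexity

open MvPolynomial Matrix Finset

/-! ### Thm. 2: counting parameters -/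

section Counting

/-- **A polynomial map onto `F^ρ` has at least `|ρ|` parameters** (the core of Hrubeš–Joglekar
2025, Thm. 2: "this gives a polynomial map `G : 𝔽^k → 𝔽^{2^n}` whose image contains all of
`𝔽^{2^n}`. This implies `k ≥ 2^n`": for finite `𝔽` by counting, `q^k ≥ q^{2^n}`; for infinite `𝔽`
the components would be algebraically dependent and a non-trivial relation would vanish on all
of `𝔽^{2^n}`, contradicting `MvPolynomial.funext` (print: Schwartz–Zippel)).
[cite: HrubesJoglekar2025, Thm. 2 (p. 53:4)] -/
theorem card_le_card_of_surjective_eval {F : Type*} [Field F] {π ρ : Type*} [Fintype π]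
    [Fintype ρ] (Q : ρ → MvPolynomial π F)
    (hQ : ∀ v : ρ → F, ∃ x : π → F, ∀ r, eval x (Q r) = v r) :
    Fintype.card ρ ≤ Fintype.card π := by
  classical
  by_contra hlt
  push Not at hlt
  rcases finite_or_infinite F with hfin | hinf
  · haveI := Fintype.ofFinite F
    have hsurj : Function.Surjective (fun (x : π → F) (r : ρ) => eval x (Q r)) := fun v => by
      obtain ⟨x, hx⟩ := hQ v
      exact ⟨x, funext hx⟩
    have h1 := Fintype.card_le_of_surjective _ hsurj
    rw [Fintype.card_fun, Fintype.card_fun] at h1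
    exact absurd h1 (not_le.2 (Nat.pow_lt_pow_right Fintype.one_lt_card hlt))
  · obtain ⟨P, hP0, hP⟩ := exists_aeval_eq_zero_of_card_lt hlt Q
    apply hP0
    apply MvPolynomial.funext
    intro v
    obtain ⟨x, hx⟩ := hQ v
    have hv : v = fun r => eval x (Q r) := funext fun r => (hx r).symm
    have hev : eval x (aeval Q P) = eval (fun r => eval x (Q r)) P := by
      rw [aeval_eq_bind₁]
      exact eval₂Hom_bind₁ _ _ _ _
    rw [map_zero, hv, ← hev, hP, map_zero]

/-- Evaluating the parameters in the coefficient (w.r.t. the first block of variables) of a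
polynomial in two blocks of variables is taking the coefficient after substituting the
parameters. [folklore] -/
theorem eval_coeff_sumAlgEquiv {F : Type*} [CommRing F] {τ π : Type*} (v : π → F) (m : τ →₀ ℕ)
    (P : MvPolynomial (τ ⊕ π) F) :
    eval v (coeff m (sumAlgEquiv F τ π P)) =
      coeff m (aeval (Sum.elim X (fun p => C (v p)) : τ ⊕ π → MvPolynomial τ F) P) := by
  have key : (MvPolynomial.map (eval v)).comp (sumAlgEquiv F τ π).toAlgHom.toRingHom =
      (aeval (Sum.elim X (fun p => C (v p)) : τ ⊕ π → MvPolynomial τ F)).toRingHom := by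
    apply ringHom_ext
    · intro a
      simp [sumAlgEquiv_C_inl]
    · rintro (t | p)
      · simp [sumAlgEquiv_X_inl]
      · simp [sumAlgEquiv_X_inr]
  have := congrArg (fun f : MvPolynomial (τ ⊕ π) F →+* MvPolynomial τ F => coeff m (f P)) key
  simpa [coeff_map] using this

/-- **The parameter count of the `2s × 2s` normal form** (Hrubeš–Joglekar 2025, proof of Thm. 2
as used in Thm. 7): if for EVERY assignment of values `c_r ∈ F` to `|ρ| = 2^k` distinct
monomials there are `a ∈ F` and a constant `2s × 2s` matrix `H` such that the coefficient of the
`r`-th monomial in `a · det (diag(X_{ι 1}, …, X_{ι s}, 0, …, 0) + H)` is `c_r` for all `r`, then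
`2^k ≤ 1 + (2s)^2` (the coefficients are polynomial functions of the `1 + 4s²` parameters
`a, H`, and `card_le_card_of_surjective_eval`). [cite: HrubesJoglekar2025, Thm. 2 (p. 53:4)] -/
theorem two_pow_le_of_forall_exists_normalForm {F : Type*} [Field F] {τ : Type*} {k s : ℕ}
    (ι : Fin s → τ) (mon : (Fin k → Bool) → (τ →₀ ℕ))
    (h : ∀ c : (Fin k → Bool) → F, ∃ (a : F) (H : Matrix (Fin s ⊕ Fin s) (Fin s ⊕ Fin s) F),
      ∀ r, coeff (mon r) (C a * (diagonal (Sum.elim (fun q => X (ι q)) 0) +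
        H.map C : Matrix _ _ (MvPolynomial τ F)).det) = c r) :
    2 ^ k ≤ 1 + (s + s) * (s + s) := by
  classical
  -- the generic scaled determinant, in the variables `τ ⊕ (parameters)`
  set Dgen : MvPolynomial (τ ⊕ (Unit ⊕ ((Fin s ⊕ Fin s) × (Fin s ⊕ Fin s)))) F :=
    X (Sum.inr (Sum.inl ())) *
      (diagonal (Sum.elim (fun q => X (Sum.inl (ι q))) 0) +
        Matrix.of fun a b => X (Sum.inr (Sum.inr (a, b)))).det with hDgen
  set Q : (Fin k → Bool) → MvPolynomial (Unit ⊕ ((Fin s ⊕ Fin s) × (Fin s ⊕ Fin s))) F :=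
    fun r => coeff (mon r) (sumAlgEquiv F τ _ Dgen) with hQdef
  have hQ : ∀ v : (Fin k → Bool) → F, ∃ x : Unit ⊕ ((Fin s ⊕ Fin s) × (Fin s ⊕ Fin s)) → F,
      ∀ r, eval x (Q r) = v r := by
    intro v
    obtain ⟨a, H, haH⟩ := h v
    refine ⟨fun x => Sum.elim (fun _ => a) (fun ab => H ab.1 ab.2) x, fun r => ?_⟩
    rw [hQdef, eval_coeff_sumAlgEquiv, ← haH r]
    congr 1
    rw [hDgen, map_mul, aeval_X, Sum.elim_inr, Sum.elim_inl, AlgHom.map_det]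
    congr 2
    ext i j
    rw [AlgHom.mapMatrix_apply, Matrix.map_apply, Matrix.add_apply, Matrix.add_apply, map_add,
      Matrix.of_apply, aeval_X, Sum.elim_inr, Sum.elim_inr, Matrix.map_apply, diagonal_apply,
      diagonal_apply]
    congr 1
    split_ifs with hij
    · rcases i with q | q
      · simp
      · simp
    · rw [map_zero]
  have hcard := card_le_card_of_surjective_eval Q hQ
  simpa [Fintype.card_sum, Fintype.card_prod, Fintype.card_fin, Fintype.card_bool,
    Fintype.card_fun, Fintype.card_unique] using hcard

end Counting

/-! ### Thm. 3 in `perm_n`: substituting constants outside `k` well-placed variables -/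

section Universality

/-- In a field of characteristic `≠ 2`, `2 ≠ 0` (a private copy of the lemma of the same
content in `PermanentBooleanSum.lean`, to keep the imports light). [folklore] -/
private theorem two_ne_zero_of_char_ne_two (F : Type*) [Field F] (h : ringChar F ≠ 2) :
    (2 : F) ≠ 0 := by
  intro h2
  have hdvd : ringChar F ∣ 2 := (ringChar.spec F 2).1 (by exact_mod_cast h2)
  have hle := Nat.le_of_dvd two_pos hdvd
  interval_cases hc : ringChar F
  · -- `ringChar F = 0`: then `2 = 0` in `F` forces `(2 : ℕ) = 0`
    haveI : CharP F 0 := hc ▸ ringChar.charP F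
    have := (CharP.cast_eq_zero_iff F 0 2).1 (by exact_mod_cast h2)
    omega
  · haveI : CharP F 1 := hc ▸ ringChar.charP F
    exact absurd (CharP.ringChar_ne_one (R := F)) (by rw [hc]; simp)
  · exact h rfl

/-- Two injections from the same type into a finite type differ by a permutation. [folklore] -/
theorem exists_perm_apply_eq {α β : Type*} [Fintype β] [DecidableEq β] (f g : α → β)
    (hf : Function.Injective f) (hg : Function.Injective g) :
    ∃ σ : Equiv.Perm β, ∀ a, σ (f a) = g a := by
  classical
  let e : {b // b ∈ Set.range f} ≃ {b // b ∈ Set.range g} :=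
    (Equiv.ofInjective f hf).symm.trans (Equiv.ofInjective g hg)
  refine ⟨e.extendSubtype, fun a => ?_⟩
  rw [Equiv.extendSubtype_apply_of_mem e (f a) ⟨a, rfl⟩]
  simp only [e, Equiv.trans_apply]
  have : (Equiv.ofInjective f hf).symm ⟨f a, ⟨a, rfl⟩⟩ = a :=
    (Equiv.ofInjective f hf).symm_apply_eq.2 rfl
  rw [this, Equiv.ofInjective_apply]

/-- The gadget matrix with constant leaf weights and `z_i = X_i` is constant off the diagonal
entries `(u_i, u_i)`. [folklore] -/
theorem treeMatrix_const {k : ℕ} {R : Type*} [CommRing R] (yv : (Fin k → Bool) → R)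
    (a b : ReadOnceTree.V k) (hab : ¬ ∃ i, a = Sum.inr i ∧ b = Sum.inr i) :
    ∃ t : R, ReadOnceTree.treeMatrix (fun g => C (yv g))
      (X : Fin k → MvPolynomial (Fin k) R) a b = C t := by
  have hneg : (-1 : MvPolynomial (Fin k) R) = C (-1) := by rw [map_neg, map_one]
  rw [ReadOnceTree.treeMatrix_apply]
  rcases b with ⟨κ, ν⟩ | i <;> rcases a with ⟨κ', ν'⟩ | i'
  case inr.inr =>
    -- the loop at `u_i` is excluded by hypothesis; no other edge between variable vertices
    simp only [ReadOnceTree.wt]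
    by_cases h : i' = i
    · exact absurd ⟨i, by rw [h], rfl⟩ hab
    · exact ⟨0, by rw [if_neg h, map_zero]⟩
  all_goals
    (try rcases κ with _ | _ | _) <;> (try rcases κ' with _ | _ | _) <;>
    simp only [ReadOnceTree.wt] <;>
    first
    | exact ⟨0, (map_zero C).symm⟩
    | (split_ifs <;> first
        | exact ⟨0, (map_zero C).symm⟩
        | exact ⟨1, (map_one C).symm⟩
        | exact ⟨yv _, rfl⟩
        | exact ⟨-1, hneg⟩)

/-- The permanent commutes with `rename`. [folklore] -/
theorem rename_permanent {R : Type*} [CommSemiring R] {σ τ : Type*} (f : σ → τ) {n : Type*}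
    [Fintype n] [DecidableEq n] (M : Matrix n n (MvPolynomial σ R)) :
    rename f M.permanent = (M.map (rename f)).permanent := by
  have h := Matrix.permanent_map_ringHom (rename f).toRingHom M
  simpa using h.symm

/-- **Universality of `perm_n` for well-placed variables** (the displayed claim in the proof of
Hrubeš–Joglekar 2025, Thm. 7, from their Thm. 3 and footnote 3: "for every multilinear
polynomial `f ∈ 𝔽[Z]`, there exists a matrix `X̄_f` obtained by setting variables outside of `Z`
to constants in `X̄` such that `f = perm_n(X̄_f)`"): over a field of characteristic `≠ 2`, if
`n ≥ |V k|` and `Z = {ζ 0, …, ζ (k-1)}` are positions with distinct rows and distinct columns,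
then for every family of coefficients `c_h` there is a substitution `S` fixing the variables of
`Z` and sending every other variable to a constant, with
`S(perm_n) = ∑_h c_h ∏_{h i} X_{ζ i}`. The matrix is the gadget `ReadOnceTree.treeMatrix`
padded by an identity block and moved into place by row and column permutations.
[cite: HrubesJoglekar2025, Thm. 7 (p. 53:6)] -/
theorem exists_subst_perPoly_eq {F : Type*} [Field F] (hF : ringChar F ≠ 2) {n k : ℕ}
    (hn : Fintype.card (ReadOnceTree.V k) ≤ n) (ζ : Fin k → Fin n × Fin n)
    (hr : Function.Injective fun i => (ζ i).1) (hc : Function.Injective fun i => (ζ i).2)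
    (c : (Fin k → Bool) → F) :
    ∃ S : Fin n × Fin n → MvPolynomial (Fin n × Fin n) F,
      (∀ i, S (ζ i) = X (ζ i)) ∧ (∀ e, (∀ i, ζ i ≠ e) → ∃ a, S e = C a) ∧
      aeval S (perPoly (Fin n) F) =
        ∑ h : Fin k → Bool, C (c h) * ∏ i, (if h i then X (ζ i) else 1) := by
  classical
  haveI : Invertible (2 : F) := invertibleOfNonzero (two_ne_zero_of_char_ne_two F hF)
  obtain ⟨yv, hyv⟩ := ReadOnceTree.exists_permanent_treeMatrix_eq (k := k) (R := F) c
  set G : Matrix (ReadOnceTree.V k) (ReadOnceTree.V k) (MvPolynomial (Fin k) F) :=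
    ReadOnceTree.treeMatrix (fun g => C (yv g)) X with hG
  -- pad by an identity block and transport to `Fin n`
  set d := n - Fintype.card (ReadOnceTree.V k) with hd
  have hcard : Fintype.card (ReadOnceTree.V k ⊕ Fin d) = Fintype.card (Fin n) := by
    rw [Fintype.card_sum, Fintype.card_fin, Fintype.card_fin, hd]; omega
  set e0 : ReadOnceTree.V k ⊕ Fin d ≃ Fin n := Fintype.equivOfCardEq hcard with he0
  set G₁ : Matrix (ReadOnceTree.V k ⊕ Fin d) (ReadOnceTree.V k ⊕ Fin d) (MvPolynomial (Fin k) F) :=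
    Matrix.fromBlocks G 0 0 1 with hG₁
  set G₂ : Matrix (Fin n) (Fin n) (MvPolynomial (Fin k) F) := G₁.submatrix e0.symm e0.symm with hG₂
  -- the diagonal positions of the `X i` in `G₂`, and permutations moving them to `ζ i`
  set dpos : Fin k → Fin n := fun i => e0 (Sum.inl (Sum.inr i)) with hdpos
  have hdpos_inj : Function.Injective dpos := fun i j h => by
    simpa [hdpos] using h
  obtain ⟨σr, hσr⟩ := exists_perm_apply_eq (fun i => (ζ i).1) dpos hr hdpos_inj
  obtain ⟨σc, hσc⟩ := exists_perm_apply_eq (fun i => (ζ i).2) dpos hc hdpos_inj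
  set G₃ : Matrix (Fin n) (Fin n) (MvPolynomial (Fin k) F) := G₂.submatrix σr σc with hG₃
  -- permanents
  have hper : G₃.permanent = ∑ h : Fin k → Bool, C (c h) * ∏ i, (if h i then X i else 1) := by
    rw [← hyv, hG₃, show G₂.submatrix σr σc = (G₂.submatrix id σc).submatrix σr id from rfl,
      Matrix.permanent_permute_cols, Matrix.permanent_permute_rows, hG₂,
      Matrix.permanent_submatrix_equiv, hG₁, Matrix.permanent_fromBlocks_zero₂₁,
      Matrix.permanent_one, mul_one]
  -- entries: `X i` at `ζ i`, constants elsewhere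
  have hG₃_apply : ∀ a b, G₃ a b = G₁ (e0.symm (σr a)) (e0.symm (σc b)) := fun a b => rfl
  have hdiagG₃ : ∀ i, G₃ (ζ i).1 (ζ i).2 = X i := by
    intro i
    rw [hG₃_apply, hσr, hσc, hdpos]
    simp only [Equiv.symm_apply_apply, hG₁, Matrix.fromBlocks_apply₁₁, hG,
      ReadOnceTree.treeMatrix_apply, ReadOnceTree.wt_u_self]
  have hconst : ∀ a b, (∀ i, ζ i ≠ (a, b)) → ∃ t : F, G₃ a b = C t := by
    intro a b hab
    rw [hG₃_apply, hG₁]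
    rcases hx : e0.symm (σr a) with x | x <;> rcases hy : e0.symm (σc b) with y | y
    · rw [Matrix.fromBlocks_apply₁₁, hG]
      refine treeMatrix_const yv x y fun ⟨i, hxi, hyi⟩ => hab i ?_
      -- then `(a, b) = ζ i`
      have ha : σr a = dpos i := by
        show σr a = e0 (Sum.inl (Sum.inr i))
        rw [← hxi, ← hx, Equiv.apply_symm_apply]
      have hb : σc b = dpos i := by
        show σc b = e0 (Sum.inl (Sum.inr i))
        rw [← hyi, ← hy, Equiv.apply_symm_apply]
      rw [← hσr i] at ha
      rw [← hσc i] at hb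
      exact Prod.ext (σr.injective ha).symm (σc.injective hb).symm
    · exact ⟨0, by rw [Matrix.fromBlocks_apply₁₂]; simp⟩
    · exact ⟨0, by rw [Matrix.fromBlocks_apply₂₁]; simp⟩
    · rw [Matrix.fromBlocks_apply₂₂, Matrix.one_apply]
      split_ifs
      · exact ⟨1, (map_one C).symm⟩
      · exact ⟨0, (map_zero C).symm⟩
  -- the substitution
  refine ⟨fun e => rename ζ (G₃ e.1 e.2), fun i => ?_, fun e he => ?_, ?_⟩
  · simp only [hdiagG₃, rename_X]
  · obtain ⟨t, ht⟩ := hconst e.1 e.2 (fun i h => he i (by rw [h]))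
    exact ⟨t, by show rename ζ (G₃ e.1 e.2) = C t; rw [ht, rename_C]⟩
  · have hmat : (Matrix.mvPolynomialX (Fin n) (Fin n) F).map
        (aeval fun e : Fin n × Fin n => rename ζ (G₃ e.1 e.2)) = G₃.map (rename ζ) := by
      ext a b
      simp [Matrix.mvPolynomialX_apply]
    unfold perPoly
    rw [← AlgHom.coe_toRingHom, ← Matrix.permanent_map_ringHom, AlgHom.coe_toRingHom, hmat,
      ← rename_permanent, hper]
    simp only [map_sum, map_mul, rename_C, map_prod]
    refine Finset.sum_congr rfl fun h _ => ?_
    congr 1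
    refine Finset.prod_congr rfl fun i _ => ?_
    split_ifs <;> simp

end Universality

/-! ### The lower bound for one block of `k` well-placed variables -/

section PerBlock

/-- The exponent vector of the multilinear monomial `∏_{h i} X_{ζ i}`. [folklore] -/
theorem prod_ite_X_eq_monomial {F : Type*} [CommSemiring F] {τ : Type*} {k : ℕ} (ζ : Fin k → τ)
    (h : Fin k → Bool) :
    (∏ i, (if h i then X (ζ i) else 1) : MvPolynomial τ F) =
      monomial (∑ i ∈ univ.filter (fun i => h i = true), Finsupp.single (ζ i) 1) 1 := by
  rw [monomial_sum_one, Finset.prod_filter]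
  rfl

/-- The exponent vectors of distinct multilinear monomials in injectively placed variables are
distinct. [folklore] -/
theorem monomialIndex_injective {τ : Type*} {k : ℕ} (ζ : Fin k → τ) (hζ : Function.Injective ζ) :
    Function.Injective fun h : Fin k → Bool =>
      ∑ i ∈ univ.filter (fun i => h i = true), (Finsupp.single (ζ i) (1 : ℕ)) := by
  classical
  have hev : ∀ (h : Fin k → Bool) (i : Fin k),
      (∑ i' ∈ univ.filter (fun i' => h i' = true), Finsupp.single (ζ i') (1 : ℕ)) (ζ i) =
        if h i = true then 1 else 0 := by
    intro h i
    rw [Finsupp.finsetSum_apply]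
    simp_rw [Finsupp.single_apply, hζ.eq_iff]
    rw [Finset.sum_ite_eq' (univ.filter fun i' => h i' = true) i (fun _ => (1 : ℕ))]
    simp
  intro h h' hh
  funext i
  have h1 := congrArg (fun f : τ →₀ ℕ => f (ζ i)) hh
  simp only [hev] at h1
  cases hi : h i <;> cases hi' : h' i <;> simp [hi, hi'] at h1 ⊢

/-- Coefficient extraction from `∑_h c_h ∏_{h i} X_{ζ i}`. [folklore] -/
theorem coeff_sum_C_mul_prod_ite_X {F : Type*} [CommSemiring F] {τ : Type*} {k : ℕ} (ζ : Fin k → τ)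
    (hζ : Function.Injective ζ) (c : (Fin k → Bool) → F) (r : Fin k → Bool) :
    coeff (∑ i ∈ univ.filter (fun i => r i = true), Finsupp.single (ζ i) 1)
      (∑ h : Fin k → Bool, C (c h) * ∏ i, (if h i then X (ζ i) else 1) : MvPolynomial τ F) = c r := by
  classical
  simp_rw [prod_ite_X_eq_monomial, coeff_sum, coeff_C_mul, coeff_monomial]
  simp_rw [(monomialIndex_injective ζ hζ).eq_iff]
  simp

/-- **The bound for one block** (Hrubeš–Joglekar 2025, proof of Thm. 7: "Hence `M` must contain
`Ω(2^{k/2})` entries from `Z`"): if `det M = perm_n` symbolically, characteristic `≠ 2`,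
`n ≥ |V k|`, and `Z = {ζ i}` has distinct rows and distinct columns, then the number `s_Z` of
entries of `M` that are variables of `Z` satisfies `2^k ≤ 1 + (2 s_Z)^2`. Proof: every family of
`2^k` coefficients is realised by a substitution of constants outside `Z`
(`exists_subst_perPoly_eq`); the substituted `M` has exactly `s_Z` variable entries, so its
determinant is `c · det (diag(X_ι, 0) + H)` (`exists_det_eq_const_mul_det_normalForm`); hence
the `2^k` coefficients are onto as a function of the `1 + 4 s_Z²` parameters
(`two_pow_le_of_forall_exists_normalForm`). [cite: HrubesJoglekar2025, Thm. 7 (p. 53:6)] -/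
theorem two_pow_le_of_block {F : Type*} [Field F] (hF : ringChar F ≠ 2) {n k m : ℕ}
    (hn : Fintype.card (ReadOnceTree.V k) ≤ n) (M : Matrix (Fin m) (Fin m) ((Fin n × Fin n) ⊕ F))
    (hM : IsSymbDetRepr (perPoly (Fin n) F) M) (ζ : Fin k → Fin n × Fin n)
    (hr : Function.Injective fun i => (ζ i).1) (hc : Function.Injective fun i => (ζ i).2) :
    2 ^ k ≤ 1 + (2 * Nat.card {p : Fin m × Fin m // ∃ i, M p.1 p.2 = Sum.inl (ζ i)}) ^ 2 := by
  classical
  have hζ : Function.Injective ζ := fun i j h => hr (by simp [h])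
  -- enumerate the `Z`-entries of `M`
  set s := Fintype.card {p : Fin m × Fin m // ∃ i, M p.1 p.2 = Sum.inl (ζ i)} with hs
  rw [Nat.card_eq_fintype_card, ← hs]
  set eP : Fin s ≃ {p : Fin m × Fin m // ∃ i, M p.1 p.2 = Sum.inl (ζ i)} :=
    (Fintype.equivFin _).symm with heP
  set pos : Fin s → Fin m × Fin m := fun q => (eP q).1 with hpos
  have hpos_inj : Function.Injective pos := fun q q' h =>
    eP.injective (Subtype.ext h)
  have hidx : ∀ q, ∃ i, M (pos q).1 (pos q).2 = Sum.inl (ζ i) := fun q => (eP q).2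
  choose idx hidx using hidx
  set ι : Fin s → Fin n × Fin n := fun q => ζ (idx q) with hι
  -- the monomials
  set mon : (Fin k → Bool) → ((Fin n × Fin n) →₀ ℕ) :=
    fun h => ∑ i ∈ univ.filter (fun i => h i = true), Finsupp.single (ζ i) 1 with hmon
  have key := two_pow_le_of_forall_exists_normalForm (F := F) ι mon (k := k) ?_
  · simpa [two_mul, sq] using key
  intro c
  obtain ⟨S, hS₁, hS₂, hS₃⟩ := exists_subst_perPoly_eq hF hn ζ hr hc c
  -- the substituted matrix: constants `C₀` plus the `Z`-variables at the positions `pos`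
  set C₀ : Matrix (Fin m) (Fin m) F := fun i j =>
    Sum.elim (fun e => if ∃ i', ζ i' = e then 0 else coeff 0 (S e)) id (M i j) with hC₀
  have hNF : (aeval S).mapMatrix (symbPoly M) =
      C₀.map C + ∑ q, (X (ι q) : MvPolynomial (Fin n × Fin n) F) •
        Matrix.single (pos q).1 (pos q).2 (1 : MvPolynomial (Fin n × Fin n) F) := by
    ext i j
    rw [AlgHom.mapMatrix_apply, Matrix.map_apply, Matrix.add_apply, Matrix.map_apply,
      Matrix.sum_apply]
    simp only [Matrix.smul_apply, Matrix.single_apply, smul_eq_mul, mul_ite, mul_one, mul_zero]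
    -- the sum over `q` has at most the term with `pos q = (i, j)`
    have hsum_pos : ∀ i', M i j = Sum.inl (ζ i') →
        (∑ q : Fin s, if (pos q).1 = i ∧ (pos q).2 = j then
          (X (ι q) : MvPolynomial (Fin n × Fin n) F) else 0) = X (ζ i') := by
      intro i' hi'
      set q₀ := eP.symm ⟨(i, j), ⟨i', hi'⟩⟩ with hq₀
      have hq₀pos : pos q₀ = (i, j) := by
        show (eP (eP.symm _)).1 = (i, j)
        rw [Equiv.apply_symm_apply]
      rw [Finset.sum_eq_single q₀ (fun q _ hq => if_neg fun h' => hq (hpos_inj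
        ((Prod.ext h'.1 h'.2).trans hq₀pos.symm))) (fun h' => absurd (Finset.mem_univ _) h'),
        if_pos ⟨congrArg Prod.fst hq₀pos, congrArg Prod.snd hq₀pos⟩]
      have h1 := hidx q₀
      rw [hq₀pos] at h1
      change M i j = Sum.inl (ζ (idx q₀)) at h1
      rw [hi'] at h1
      have h2 : ζ i' = ζ (idx q₀) := Sum.inl_injective h1
      simp only [hι, ← h2]
    have hsum_neg : (¬ ∃ i', M i j = Sum.inl (ζ i')) →
        (∑ q : Fin s, if (pos q).1 = i ∧ (pos q).2 = j then
          (X (ι q) : MvPolynomial (Fin n × Fin n) F) else 0) = 0 := by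
      intro hne
      refine Finset.sum_eq_zero fun q _ => if_neg fun h' => hne ⟨idx q, ?_⟩
      have h1 := hidx q
      rwa [show pos q = (i, j) from Prod.ext h'.1 h'.2] at h1
    rcases hMij : M i j with e | a
    · by_cases he : ∃ i', ζ i' = e
      · obtain ⟨i', rfl⟩ := he
        rw [hsum_pos i' hMij]
        simp only [symbPoly, Matrix.map_apply, hMij, Sum.elim_inl, aeval_X, hS₁, hC₀]
        rw [if_pos ⟨i', rfl⟩, map_zero, zero_add]
      · obtain ⟨a, ha⟩ := hS₂ e fun i' h => he ⟨i', h⟩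
        rw [hsum_neg fun ⟨i', h⟩ => he ⟨i', by
          rw [hMij] at h; exact (Sum.inl_injective h).symm⟩]
        simp only [symbPoly, Matrix.map_apply, hMij, Sum.elim_inl, aeval_X, hC₀, ha, if_neg he,
          coeff_zero_C, add_zero]
    · rw [hsum_neg fun ⟨i', h⟩ => by rw [hMij] at h; cases h]
      simp only [symbPoly, Matrix.map_apply, hMij, Sum.elim_inr, aeval_C, hC₀, id, add_zero]
      rfl
  -- apply the normal form
  obtain ⟨a, H, hdet⟩ := Literature.LinearAlgebra.Matrix.exists_det_eq_const_mul_det_normalForm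
    (R' := MvPolynomial (Fin n × Fin n) F) C₀ pos (fun q => X (ι q))
  rw [MvPolynomial.algebraMap_eq] at hdet
  refine ⟨a, H, fun r => ?_⟩
  have hmain : (∑ h : Fin k → Bool, C (c h) * ∏ i, (if h i then X (ζ i) else 1)) =
      C a * (diagonal (Sum.elim (fun q => X (ι q)) 0) + H.map C).det := by
    rw [← hdet, ← hNF, ← AlgHom.map_det, ← hS₃]
    exact (congrArg (aeval S) hM).symm
  rw [← hmain, hmon]
  exact coeff_sum_C_mul_prod_ite_X ζ hζ c r

end PerBlock

/-! ### The size of the gadget -/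

section GadgetSize

open ReadOnceTree

/-- The complete binary tree of depth `k` has at most `2^{k+1}` nodes (in fact `2^{k+1} - 1`): a
leaf is coded by its bit string, an internal node of depth `d` by its bit string with an extra
`1` at position `d` (the last `1` of the code). [folklore] -/
theorem card_node_le (k : ℕ) : Fintype.card (Node k) ≤ 2 ^ (k + 1) := by
  classical
  let f : Node k → (Fin k → Bool) ⊕ (Fin k → Bool) := fun ν =>
    if h : ν.depth < k then Sum.inr (Function.update ν.bits ⟨ν.depth, h⟩ true) else Sum.inl ν.bits
  have hf : Function.Injective f := by
    intro ν ν' hνν'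
    simp only [f] at hνν'
    by_cases h : ν.depth < k <;> by_cases h' : ν'.depth < k <;>
      simp only [h, h', dif_pos, dif_neg, not_false_eq_true, Sum.inr.injEq, Sum.inl.injEq,
        reduceCtorEq] at hνν'
    · -- two internal nodes
      have hd : ν.depth = ν'.depth := by
        by_contra hne
        rcases Nat.lt_or_gt_of_ne hne with hlt | hlt
        · have := congrFun hνν' ⟨ν'.depth, h'⟩
          rw [Function.update_of_ne (fun e => by simp [Fin.ext_iff] at e; omega),
            Function.update_self, ν.bits_eq_false _ (by simp; omega)] at this
          exact Bool.false_ne_true this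
        · have := congrFun hνν' ⟨ν.depth, h⟩
          rw [Function.update_self, Function.update_of_ne (fun e => by simp [Fin.ext_iff] at e; omega),
            ν'.bits_eq_false _ (by simp; omega)] at this
          exact Bool.false_ne_true this.symm
      refine Node.ext hd (funext fun t => ?_)
      by_cases ht : (t : ℕ) = ν.depth
      · rw [ν.bits_eq_false t (by omega), ν'.bits_eq_false t (by omega)]
      · have := congrFun hνν' t
        rwa [Function.update_of_ne (fun e => ht (by rw [e])),
          Function.update_of_ne (fun e => ht (by rw [e, hd]))] at this
    · -- two leaves
      exact Node.ext (by have := ν.depth_le; have := ν'.depth_le; omega) hνν'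
  have := Fintype.card_le_of_injective f hf
  simp only [Fintype.card_sum, Fintype.card_fun, Fintype.card_bool, Fintype.card_fin] at this
  rw [pow_succ]
  omega

/-- The gadget has at most `3 · 2^{k+1} + k` vertices. [folklore] -/
theorem card_V_le (k : ℕ) : Fintype.card (V k) ≤ 3 * 2 ^ (k + 1) + k := by
  have h1 : Fintype.card (V k) = 3 * Fintype.card (Node k) + k := by
    simp only [Fintype.card_sum, Fintype.card_prod, Fintype.card_fin]
    rfl
  rw [h1]
  have := card_node_le k
  omega

/-- In particular `|V k| ≤ 2^{k+3}`. [folklore] -/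
theorem card_V_le_two_pow (k : ℕ) : Fintype.card (V k) ≤ 2 ^ (k + 3) := by
  have h1 := card_V_le k
  have h2 : k < 2 ^ k := Nat.lt_two_pow_self
  have h3 : 2 ^ (k + 3) = 8 * 2 ^ k := by ring
  have h4 : 2 ^ (k + 1) = 2 * 2 ^ k := by ring
  omega

end GadgetSize

/-! ### The transversal blocks `Z_{a,b}` of the `n × n` variable matrix -/

section Blocks

variable {n : ℕ} {k : ℕ}

/-- The row index `k b + i` of the `i`-th variable of the block `(a, b)`. [folklore] -/
theorem blockRow_lt (b : Fin (n / k)) (i : Fin k) : k * (b : ℕ) + i < n := by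
  have hb : (b : ℕ) + 1 ≤ n / k := b.2
  have h1 : k * ((b : ℕ) + 1) ≤ k * (n / k) := Nat.mul_le_mul_left k hb
  have h2 : k * (n / k) ≤ n := Nat.mul_div_le n k
  have := i.2
  nlinarith

/-- The block `Z_{a,b} = {(k b + i, k b + i + a) : i < k}` (rows `k b, …, k b + k - 1`, columns
shifted by `a` modulo `n`), as an injectively row- and column-placed family of positions
(Hrubeš–Joglekar 2025, proof of Thm. 7: "Inside `X`, we can find `t = n ⌊n/k⌋` such disjoint
sets `Z_1, …, Z_t`"). [cite: HrubesJoglekar2025, Thm. 7 (p. 53:6)] -/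
theorem block_injective_fst (a : Fin n) (b : Fin (n / k)) :
    Function.Injective fun i : Fin k =>
      ((⟨k * (b : ℕ) + i, blockRow_lt b i⟩ : Fin n), (⟨k * (b : ℕ) + i, blockRow_lt b i⟩ : Fin n) + a).1 := by
  intro i j h
  simp only [Fin.mk.injEq] at h
  exact Fin.ext (by omega)

/-- The columns of a block are distinct (translation by `a` is injective in `ℤ/n`). [folklore] -/
theorem block_injective_snd (a : Fin n) (b : Fin (n / k)) :
    Function.Injective fun i : Fin k =>
      ((⟨k * (b : ℕ) + i, blockRow_lt b i⟩ : Fin n), (⟨k * (b : ℕ) + i, blockRow_lt b i⟩ : Fin n) + a).2 := by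
  intro i j h
  have h' := add_right_cancel (h : (⟨k * (b : ℕ) + i, blockRow_lt b i⟩ : Fin n) + a =
    (⟨k * (b : ℕ) + j, blockRow_lt b j⟩ : Fin n) + a)
  simp only [Fin.mk.injEq] at h'
  exact Fin.ext (by omega)

/-- Distinct blocks are disjoint: the position determines `(a, b, i)`. [folklore] -/
theorem block_disjoint {a a' : Fin n} {b b' : Fin (n / k)} {i i' : Fin k}
    (h : ((⟨k * (b : ℕ) + i, blockRow_lt b i⟩ : Fin n), (⟨k * (b : ℕ) + i, blockRow_lt b i⟩ : Fin n) + a) =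
      ((⟨k * (b' : ℕ) + i', blockRow_lt b' i'⟩ : Fin n), (⟨k * (b' : ℕ) + i', blockRow_lt b' i'⟩ : Fin n) + a')) :
    a = a' ∧ b = b' := by
  have h1 := congrArg Prod.fst h
  have h2 := congrArg Prod.snd h
  simp only [Fin.mk.injEq] at h1
  have hk : 0 < k := Nat.pos_of_ne_zero fun hk => by subst hk; exact i.elim0
  have hb : (b : ℕ) = b' := by
    have e1 : (k * (b : ℕ) + i) / k = b := by
      rw [Nat.mul_add_div hk, Nat.div_eq_of_lt i.2, add_zero]
    have e2 : (k * (b' : ℕ) + i') / k = b' := by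
      rw [Nat.mul_add_div hk, Nat.div_eq_of_lt i'.2, add_zero]
    rw [← e1, ← e2, h1]
  refine ⟨?_, Fin.ext hb⟩
  have hrow : (⟨k * (b : ℕ) + i, blockRow_lt b i⟩ : Fin n) = ⟨k * (b' : ℕ) + i', blockRow_lt b' i'⟩ :=
    Fin.ext h1
  rw [hrow] at h2
  exact add_left_cancel h2

end Blocks

/-! ### Assembly: Thm. 7 and Cor. 8 -/

section Assembly

/-- **Summing over the blocks**: the `Z_{a,b}`-entries of `M`, over all `n ⌊n/k⌋` blocks, are
pairwise disjoint sets of variable entries, so their numbers add up to at most the variable size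
("Since the sets are disjoint, `M` contains `Ω(t 2^{k/2})` entries from `X` altogether").
[cite: HrubesJoglekar2025, Thm. 7 (p. 53:6)] -/
theorem sum_blocks_le_variableSize {F : Type*} {n k m : ℕ}
    (M : Matrix (Fin m) (Fin m) ((Fin n × Fin n) ⊕ F)) :
    ∑ ab : Fin n × Fin (n / k), Nat.card {p : Fin m × Fin m // ∃ i : Fin k,
        M p.1 p.2 = Sum.inl ((⟨k * (ab.2 : ℕ) + i, blockRow_lt ab.2 i⟩ : Fin n),
          (⟨k * (ab.2 : ℕ) + i, blockRow_lt ab.2 i⟩ : Fin n) + ab.1)} ≤ variableSize M := by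
  classical
  unfold variableSize
  simp_rw [Nat.card_eq_fintype_card]
  rw [← Fintype.card_sigma]
  refine Fintype.card_le_of_injective (fun x => ⟨x.2.1, x.2.2.elim fun i h => ⟨_, h⟩⟩) ?_
  rintro ⟨ab, p, hp⟩ ⟨ab', p', hp'⟩ h
  simp only [Subtype.mk.injEq] at h
  subst h
  obtain ⟨i, hi⟩ := hp
  obtain ⟨i', hi'⟩ := hp'
  have hab : ab = ab' := by
    have := hi.symm.trans hi'
    obtain ⟨h1, h2⟩ := block_disjoint (Sum.inl_injective this)
    exact Prod.ext h1 h2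
  subst hab
  rfl

/-- **Thm. 7 before the asymptotics**: if `det M = perm_n` symbolically (char `≠ 2`) and
`n ≥ |V k|`, `k ≥ 1`, then `variableSize M ≥ n ⌊n/k⌋ · (√(2^k) - 1)/2` (each of the
`n ⌊n/k⌋` disjoint blocks contributes `s_Z` with `2^k ≤ 1 + 4 s_Z² ≤ (2 s_Z + 1)²`).
[cite: HrubesJoglekar2025, Thm. 7 (p. 53:6)] -/
theorem variableSize_ge_blocks {F : Type*} [Field F] (hF : ringChar F ≠ 2) {n k m : ℕ}
    (hn : Fintype.card (ReadOnceTree.V k) ≤ n) (M : Matrix (Fin m) (Fin m) ((Fin n × Fin n) ⊕ F))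
    (hM : IsSymbDetRepr (perPoly (Fin n) F) M) :
    ((n * (n / k) : ℕ) : ℝ) * ((Real.sqrt (2 ^ k) - 1) / 2) ≤ (variableSize M : ℝ) := by
  classical
  have hsum := sum_blocks_le_variableSize (F := F) (n := n) (k := k) M
  -- each block contributes at least `(√(2^k) - 1)/2`
  have hblock : ∀ ab : Fin n × Fin (n / k), (Real.sqrt (2 ^ k) - 1) / 2 ≤
      (Nat.card {p : Fin m × Fin m // ∃ i : Fin k,
        M p.1 p.2 = Sum.inl ((⟨k * (ab.2 : ℕ) + i, blockRow_lt ab.2 i⟩ : Fin n),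
          (⟨k * (ab.2 : ℕ) + i, blockRow_lt ab.2 i⟩ : Fin n) + ab.1)} : ℝ) := by
    intro ab
    have h := two_pow_le_of_block hF hn M hM _ (block_injective_fst ab.1 ab.2)
      (block_injective_snd ab.1 ab.2)
    set sZ := Nat.card {p : Fin m × Fin m // ∃ i : Fin k,
        M p.1 p.2 = Sum.inl ((⟨k * (ab.2 : ℕ) + i, blockRow_lt ab.2 i⟩ : Fin n),
          (⟨k * (ab.2 : ℕ) + i, blockRow_lt ab.2 i⟩ : Fin n) + ab.1)}
    have h' : (2 : ℝ) ^ k ≤ (2 * sZ + 1) ^ 2 := by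
      have : ((2 ^ k : ℕ) : ℝ) ≤ ((1 + (2 * sZ) ^ 2 : ℕ) : ℝ) := by exact_mod_cast h
      push_cast at this
      have hs0 : (0 : ℝ) ≤ sZ := Nat.cast_nonneg _
      nlinarith
    have hsq : Real.sqrt (2 ^ k) ≤ 2 * sZ + 1 := by
      rw [← Real.sqrt_sq (by positivity : (0 : ℝ) ≤ 2 * sZ + 1)]
      exact Real.sqrt_le_sqrt h'
    linarith
  have hcast : ((∑ ab : Fin n × Fin (n / k), Nat.card {p : Fin m × Fin m // ∃ i : Fin k,
        M p.1 p.2 = Sum.inl ((⟨k * (ab.2 : ℕ) + i, blockRow_lt ab.2 i⟩ : Fin n),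
          (⟨k * (ab.2 : ℕ) + i, blockRow_lt ab.2 i⟩ : Fin n) + ab.1)} : ℕ) : ℝ) ≤
      (variableSize M : ℝ) := by exact_mod_cast hsum
  refine le_trans ?_ hcast
  rw [Nat.cast_sum]
  calc ((n * (n / k) : ℕ) : ℝ) * ((Real.sqrt (2 ^ k) - 1) / 2)
      = ∑ _ab : Fin n × Fin (n / k), (Real.sqrt (2 ^ k) - 1) / 2 := by
        rw [Finset.sum_const, Finset.card_univ, Fintype.card_prod, Fintype.card_fin,
          Fintype.card_fin, nsmul_eq_mul]
    _ ≤ _ := Finset.sum_le_sum fun ab _ => hblock ab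

/-- **Hrubeš–Joglekar 2025, Thm. 7** (discharge of the named fact
`HrubesJoglekar2025_variableSize_perPoly`): over a field of characteristic `≠ 2`, every symbolic
determinantal representation of `perm_n` has variable size at least `c · n^{5/2} / log n` for
`n ≥ n₀`; here `c = log 2 / 64`, `n₀ = 2^16`, with `k = ⌊log₂ n⌋ - 3` (so that the gadget fits:
`|V k| ≤ 2^{k+3} ≤ n`, and `2^k > n/16`). The printed proof, with Thm. 3 replaced by the explicit
gadget of `ReadOncePermanentTree.lean`. [cite: HrubesJoglekar2025, Thm. 7 (p. 53:5)] -/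
theorem HrubesJoglekar2025_variableSize_perPoly_holds : HrubesJoglekar2025_variableSize_perPoly := by
  intro F _ hF
  refine ⟨Real.log 2 / 64, by positivity, 2 ^ 16, fun n hn m M hM => ?_⟩
  -- the parameters
  set L := Nat.log 2 n with hL
  have hn0 : n ≠ 0 := by
    have : (0 : ℕ) < 2 ^ 16 := by positivity
    omega
  have h2L : 2 ^ L ≤ n := Nat.pow_log_le_self 2 hn0
  have hnL : n < 2 ^ (L + 1) := Nat.lt_pow_succ_log_self (by norm_num) n
  have hL16 : 16 ≤ L := by
    by_contra h
    push Not at h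
    have : 2 ^ (L + 1) ≤ 2 ^ 16 := Nat.pow_le_pow_right (by norm_num) (by omega)
    omega
  set k := L - 3 with hk
  have hkL : k + 3 = L := by omega
  have hk4 : n < 2 ^ (k + 4) := by rw [show k + 4 = L + 1 by omega]; exact hnL
  have hVn : Fintype.card (ReadOnceTree.V k) ≤ n :=
    (card_V_le_two_pow k).trans (by rw [hkL]; exact h2L)
  have hmain := variableSize_ge_blocks hF hVn M hM
  -- real-number bookkeeping
  have hN1 : (1 : ℝ) < n := by exact_mod_cast (show 1 < n by omega)
  have hNpos : (0 : ℝ) < n := by linarith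
  have hlogN : 0 < Real.log n := Real.log_pos hN1
  have hlog2 : 0 < Real.log 2 := Real.log_pos (by norm_num)
  have hKpos : (0 : ℝ) < k := by exact_mod_cast (show 0 < k by omega)
  -- `k ≤ log₂ n`
  have hK : (k : ℝ) * Real.log 2 ≤ Real.log n := by
    have h1 : ((2 ^ L : ℕ) : ℝ) ≤ n := by exact_mod_cast h2L
    have h2 : Real.log ((2 ^ L : ℕ) : ℝ) ≤ Real.log n := Real.log_le_log (by positivity) h1
    rw [Nat.cast_pow, Nat.cast_ofNat, Real.log_pow] at h2
    have h3 : (k : ℝ) ≤ L := by exact_mod_cast (show k ≤ L by omega)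
    nlinarith
  have hKinv : Real.log 2 / Real.log n ≤ 1 / k := by
    rw [div_le_div_iff₀ hlogN hKpos]; linarith
  -- `⌊n/k⌋ ≥ n / (2k)`
  have hq : (n : ℝ) / (2 * k) ≤ ((n / k : ℕ) : ℝ) := by
    have h1 : n < k * (n / k) + k := by
      have := Nat.div_add_mod n k
      have := Nat.mod_lt n (show 0 < k by omega)
      omega
    have h2 : (n : ℝ) < k * ((n / k : ℕ) : ℝ) + k := by exact_mod_cast h1
    have h3 : 2 * (k : ℝ) ≤ n := by
      have : 2 * k ≤ n := by
        have : 2 * L ≤ 2 ^ L := by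
          have := Nat.lt_two_pow_self (n := L)
          -- `2L ≤ 2^L` for `L ≥ 2`
          calc 2 * L ≤ 2 ^ (L - 1) * 2 := by
                have h' : L ≤ 2 ^ (L - 1) := by
                  have := Nat.lt_two_pow_self (n := L - 1); omega
                omega
            _ = 2 ^ L := by rw [← pow_succ]; congr 1; omega
        omega
      exact_mod_cast this
    rw [div_le_iff₀ (by positivity)]
    nlinarith
  -- `(√(2^k) - 1)/2 ≥ √n / 16`
  have hsqrtN : (256 : ℝ) ≤ Real.sqrt n := by
    rw [Real.le_sqrt (by norm_num) hNpos.le]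
    exact_mod_cast (show (65536 : ℕ) ≤ n by simpa using hn)
  have hb : Real.sqrt n / 16 ≤ (Real.sqrt (2 ^ k) - 1) / 2 := by
    have h1 : (n : ℝ) / 16 ≤ 2 ^ k := by
      have : ((n : ℕ) : ℝ) < ((2 ^ (k + 4) : ℕ) : ℝ) := by exact_mod_cast hk4
      push_cast at this
      have : (2 : ℝ) ^ (k + 4) = 16 * 2 ^ k := by ring
      linarith
    have h2 : Real.sqrt n / 4 ≤ Real.sqrt (2 ^ k) := by
      have := Real.sqrt_le_sqrt h1
      rw [Real.sqrt_div hNpos.le, show Real.sqrt 16 = 4 by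
        rw [show (16 : ℝ) = 4 ^ 2 by norm_num, Real.sqrt_sq (by norm_num)]] at this
      exact this
    linarith
  -- combine
  have hpow : (n : ℝ) ^ ((5 : ℝ) / 2) = (n : ℝ) ^ 2 * Real.sqrt n := by
    rw [Real.sqrt_eq_rpow, show ((5 : ℝ) / 2) = (2 : ℝ) + 1 / 2 by norm_num,
      Real.rpow_add hNpos, Real.rpow_two]
  rw [hpow]
  have hqpos : (0 : ℝ) ≤ (n : ℝ) / (2 * k) := by positivity
  have hbpos : (0 : ℝ) ≤ Real.sqrt n / 16 := by positivity
  calc Real.log 2 / 64 * ((n : ℝ) ^ 2 * Real.sqrt n) / Real.log n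
      ≤ (1 / 32) * ((n : ℝ) ^ 2 * Real.sqrt n) * (Real.log 2 / Real.log n) := by
        have e : Real.log 2 / 64 * ((n : ℝ) ^ 2 * Real.sqrt n) / Real.log n =
            (1 / 2) * ((1 / 32) * ((n : ℝ) ^ 2 * Real.sqrt n) * (Real.log 2 / Real.log n)) := by
          ring
        rw [e]
        have : 0 ≤ (1 / 32) * ((n : ℝ) ^ 2 * Real.sqrt n) * (Real.log 2 / Real.log n) := by
          positivity
        linarith
    _ ≤ (1 / 32) * ((n : ℝ) ^ 2 * Real.sqrt n) * (1 / k) := by gcongr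
    _ = (n : ℝ) * ((n : ℝ) / (2 * k)) * (Real.sqrt n / 16) := by
        field_simp
        ring
    _ ≤ (n : ℝ) * ((n / k : ℕ) : ℝ) * ((Real.sqrt (2 ^ k) - 1) / 2) := by gcongr
    _ = ((n * (n / k) : ℕ) : ℝ) * ((Real.sqrt (2 ^ k) - 1) / 2) := by push_cast; ring
    _ ≤ (variableSize M : ℝ) := hmain

/-- **Hrubeš–Joglekar 2025, Cor. 8** (discharge of the named fact
`HrubesJoglekar2025_readK_perPoly`): over a field of characteristic `≠ 2`, every read-`k`
determinantal representation of `perm_n` requires `k ≥ Ω(√n / log n)` — from Thm. 7 and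
`variableSize M ≤ n² k`. [cite: HrubesJoglekar2025, Cor. 8 (p. 53:6)] -/
theorem HrubesJoglekar2025_readK_perPoly_holds : HrubesJoglekar2025_readK_perPoly :=
  HrubesJoglekar2025_readK_perPoly_of_variableSize HrubesJoglekar2025_variableSize_perPoly_holds

end Assembly

end Literature.Computability.AlgebraicComplexity
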